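import Summits.MatrixMultiplication.MatrixMultiplication.Theorems.AbelianSTPPCensusTAStatEDefs

/-!
# T_A static certificate, range `6380 … 6779` (t*-indexed linear checker with the k-member tree at `τ = 2371/1000`): kernel evaluation, the shape checks of the tree-heavy volumes `4032` on order sub-ranges of at most 60 orders and ≈ 15000 tree nodes (one theorem per (volume, sub-range): bounded kernel recursion depth and memory)

Cell mm-stpp (rung F-M1), tier T_A = «beat `2.371`, the record exponent (ADVXXZ'25 / DEK+26 rounded)»; checker in `AbelianSTPPCensusTAStatEDefs.lean`, table and bucket lists in `AbelianSTPPCensusTAStatEData.lean`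
(pattern: theory g12's `AbelianSTPPCensusTAStatDDom*/DCk*.lean`).  `decide` with kernel reduction (standard axioms; no `native_decide`), `Elab.async false`;
consumed by `TAStatE.checkV_sound` / `TAStatE.domV_sound` / `TAStatE.m2V_sound` in the leaf `AbelianSTPPCensusLeafTA6779Closed.lean`.
WHAT THIS IS NOT: arithmetic on shape lists only; no statement about STPP families or `ω`.
-/

set_option linter.dupNamespace false
set_option autoImplicit false
set_option Elab.async false

namespace Summit.MatrixMultiplication.MatrixMultiplication.Theorems.TAStatE

set_option maxHeartbeats 0 in
/-- Heavy volume `4032`, orders `6758 … 6758` (13125 tree nodes): every sorted candidate shape passes `checkShape 6758 6758`. [original] -/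
theorem ck4032t14 : TAStatE.checkV 6758 6758 1 4032 = true := by decide +kernel

set_option maxHeartbeats 0 in
/-- Heavy volume `4032`, orders `6759 … 6759` (13107 tree nodes): every sorted candidate shape passes `checkShape 6759 6759`. [original] -/
theorem ck4032t15 : TAStatE.checkV 6759 6759 1 4032 = true := by decide +kernel

set_option maxHeartbeats 0 in
/-- Heavy volume `4032`, orders `6760 … 6760` (13038 tree nodes): every sorted candidate shape passes `checkShape 6760 6760`. [original] -/
theorem ck4032t16 : TAStatE.checkV 6760 6760 1 4032 = true := by decide +kernel

set_option maxHeartbeats 0 in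
/-- Heavy volume `4032`, orders `6761 … 6761` (12944 tree nodes): every sorted candidate shape passes `checkShape 6761 6761`. [original] -/
theorem ck4032t17 : TAStatE.checkV 6761 6761 1 4032 = true := by decide +kernel

end Summit.MatrixMultiplication.MatrixMultiplication.Theorems.TAStatE
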